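import Summits.MatrixMultiplication.OmegaCensus.DominoZ7Z7Consist10x31Reps
import Summits.MatrixMultiplication.OmegaCensus.DominoZpZpConsistTri
import HarnessLib

/-!
# Cell `(1,10,31)@931` over `ℤ_7²`, moment-consistency route: triangular row verdicts A (1 of 33)

ω-census `pub-omega`, family (b3), seat pub-omega-group gen 27.  Framing: lottery ticket; floor = certified bounds/negative
ranges.  VALUE: kernel instance data of the moment-consistency route (`DominoZpZpConsist*.lean`, G5 of
`HOME/pub-omega-group-g26/FAMILY-B-ADDENDUM-g26.md`) for the census cell `(1,10,31)@931` (`A ↠ ℤ_7 × ℤ_7`, `|A| = 931 = 7·133`);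
NOT progress on ω.  Generated by `HOME/pub-omega-group-g27/code/gen_cell.py` from the exact line census of gen 26
(`table_p7_d10_e31.json`, engines E1 = E2), every certificate re-verified by independent integer arithmetic before emission.

Triangular row verdicts `triRow 7 5 Lst L0 i = true` (`Lst = expandLst 7 (lstOfTable tabZ7d10)`, `L0 = l0Z7d10`, row `i` against the
columns `j ≥ i`) for the rows `0 ≤ i < 3` — 3 kernel `decide`s of ≤ 330 pivot pairs each (orders 2..5).
-/

namespace Summit.MatrixMultiplication.OmegaCensus

open ZpZpDomino

namespace ZpZpDomino

set_option maxRecDepth 100000 in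
set_option maxHeartbeats 4000000 in
/-- Rows `0 ≤ i < 1` (215 pivot pairs): every pair is DEAD (kernel `decide`). [folklore] -/
theorem triZ7d10_0 : (List.range' 0 1).all (triRow 7 5 (expandLst 7 (lstOfTable tabZ7d10)) l0Z7d10) = true := by
  decide +kernel

set_option maxRecDepth 100000 in
set_option maxHeartbeats 4000000 in
/-- Rows `1 ≤ i < 2` (214 pivot pairs): every pair is DEAD (kernel `decide`). [folklore] -/
theorem triZ7d10_1 : (List.range' 1 1).all (triRow 7 5 (expandLst 7 (lstOfTable tabZ7d10)) l0Z7d10) = true := by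
  decide +kernel

set_option maxRecDepth 100000 in
set_option maxHeartbeats 4000000 in
/-- Rows `2 ≤ i < 3` (213 pivot pairs): every pair is DEAD (kernel `decide`). [folklore] -/
theorem triZ7d10_2 : (List.range' 2 1).all (triRow 7 5 (expandLst 7 (lstOfTable tabZ7d10)) l0Z7d10) = true := by
  decide +kernel

/-- Rows `0 ≤ i < 3` of this file together. [folklore] -/
theorem triFZ7d10_A : (List.range' 0 3).all (triRow 7 5 (expandLst 7 (lstOfTable tabZ7d10)) l0Z7d10) = true := by
  have e : List.range' 0 3 = List.range' 0 1 ++ List.range' 1 1 ++ List.range' 2 1 := by decide +kernel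
  rw [e]; simp only [List.all_append, triZ7d10_0, triZ7d10_1, triZ7d10_2, Bool.and_self]


end ZpZpDomino

end Summit.MatrixMultiplication.OmegaCensus
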